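import Mathlib.Tactic.Group
import Mathlib.Tactic.Linarith
import Literature.AnabelianGeometry.SemiGraphs.PSCCoveringDatum
import HarnessLib

/-!
# Coverings of sturdy PSC data are sturdy; noncuspidality ([CombGC] Def. 1.1 (ii), Rmk. 1.1.5)

Mochizuki, *A combinatorial version of the Grothendieck conjecture*, Tohoku Math. J. **59** (2007)
[CombGC], Remark 1.1.5 (author's ms p. 8): "the condition that a semi-graph of anabelioids `G` of
PSC-type be sturdy corresponds to the condition that every irreducible component of the pointed
stable curve that gives rise to `G` be of genus `≥ 2`", used in §1 together with "replace `G` by a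
finite étale `Π_G`-covering" (Thm. 1.6 (ii) p. 14: after "we may assume … sturdy", "we may always
replace `G`, `H` by finite étale coverings") [cite: MochizukiCombGC2007, Rmk 1.1.5 p.8].  For the
covering datum `G_U = G.restrict U hU` (`PSCCoveringDatum.lean`, genera by Riemann–Hurwitz) this
PROOF-ONLY file checks the two elementary facts behind that usage:

* `branchCount_restrict_le` — the vertex `w` of `G_U` over `v`, of local degree `d_w`, has at most
  `d_w · b_v` branches (each cusp / node-branch at `v` has at most `d_w = [Π_v^y : U ∩ Π_v^y]`
  preimages at `w`: `card_filter_dcIdx_le`, an injection into `Π_v^y / (U ∩ Π_v^y)`);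
* hence Riemann–Hurwitz gives `g_w ≥ g_v` as soon as `g_v ≥ 1` (`genus_le_restrict_genus`), and
  **`IsSturdy.restrict`: if `G` is sturdy then so is every `G_U`**;
* `cuspCount_eq_zero_iff` / `isNoncuspidal_restrict_iff`: `G_U` is noncuspidal iff `G` is.

Pure group theory and arithmetic over the definition file; no new definitions; no statement here
takes a side on [IUTchIII] Cor. 3.12.
-/

namespace Literature.AnabelianGeometry.SemiGraphs

open scoped Pointwise

universe u

/-! ### Branch bookkeeping on the underlying semi-graphs -/

namespace PSCSemiGraph

/-- The node-branch contribution of an edge with end vertices `a`, `b` at the vertex `w` is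
`[a = w] + [b = w]`. [cite: MochizukiCombGC2007, Def 1.1(i) p.6] -/
theorem nodeContrib_eq {V : Type*} [DecidableEq V] (a b w : V) :
    (if s(a, b) = s(w, w) then 2 else if w ∈ s(a, b) then 1 else 0) =
      (if a = w then 1 else 0) + (if b = w then 1 else 0) := by
  by_cases ha : a = w <;> by_cases hb : b = w
  · subst ha; subst hb; simp
  · subst ha; simp [hb, Ne.symm hb]
  · subst hb; simp [ha, Ne.symm ha]
  · simp [ha, hb, Ne.symm ha, Ne.symm hb, Sym2.mem_iff]

/-- The branch count through ANY presentation of the end vertices of the nodes.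
[cite: MochizukiCombGC2007, Def 1.1(i) p.6] -/
theorem branchCount_eq_of_nodeEnds (𝔾 : PSCSemiGraph) (fst snd : 𝔾.N → 𝔾.V)
    (h : ∀ e, 𝔾.nodeEnds e = s(fst e, snd e)) (v : 𝔾.V) :
    𝔾.branchCount v = (Finset.univ.filter fun c : 𝔾.C => 𝔾.cuspEnd c = v).card +
      ∑ e : 𝔾.N, ((if fst e = v then 1 else 0) + (if snd e = v then 1 else 0)) := by
  simp only [branchCount, h, nodeContrib_eq]

end PSCSemiGraph

namespace PSCCovering

variable {P : Type u} [Group P] (U : Subgroup P) [U.FiniteIndex]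

/-- **At most `d_w` preimages per branch.**  For `K ⊆ Π` (a cusp / node group), `V` (a vertex
group) and `g` (a branch conjugator, `g K g⁻¹ ⊆ V` — not needed for the count), the enumerated double
cosets `U x_i K` whose attached vertex `U x_i g⁻¹ V` is the `j`-th one, `U y V`, are at most
`[y V y⁻¹ : U ∩ y V y⁻¹]` in number: `i ↦ (U ∩ V^y) y k_i⁻¹ y⁻¹`, where `x_i g⁻¹ = u_i y k_i`, is
injective. [cite: MochizukiCombGC2007, Def 1.1(ii) p.6] -/
theorem card_filter_dcIdx_le (K V : Subgroup P) (g : P) (j : dcFin U V) :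
    (Finset.univ.filter fun i : dcFin U K => dcIdx U V (dcRep U K i * g⁻¹) = j).card ≤
      U.relIndex (ConjAct.toConjAct (dcRep U V j) • V) := by
  classical
  set y := dcRep U V j with hy
  let Y : Subgroup P := ConjAct.toConjAct y • V
  -- for `i` in the fibre, `x_i g⁻¹ = u * y * k` with `u ∈ U`, `k ∈ V` (chosen)
  have hdec : ∀ i : {i : dcFin U K // dcIdx U V (dcRep U K i * g⁻¹) = j},
      ∃ u ∈ U, ∃ k ∈ V, dcRep U K i.1 * g⁻¹ = u * y * k := by
    intro i
    obtain ⟨u, hu, k, hk, e⟩ := (dcIdx_eq_iff U V).mp (i.2.trans (dcIdx_dcRep U V j).symm)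
    refine ⟨u⁻¹, U.inv_mem hu, k⁻¹, V.inv_mem hk, ?_⟩
    rw [hy, e]; group
  choose uu huu kk hkk hdec using hdec
  -- the map into the left cosets of `U ∩ Y` in `Y`
  have hmemY : ∀ i, y * (kk i)⁻¹ * y⁻¹ ∈ Y := fun i => by
    rw [Subgroup.mem_pointwise_smul_iff_inv_smul_mem, ← ConjAct.toConjAct_inv, ConjAct.smul_def,
      ConjAct.ofConjAct_toConjAct, inv_inv]
    simpa only [mul_assoc, inv_mul_cancel_left, inv_mul_cancel, mul_one] using V.inv_mem (hkk i)
  let f : {i : dcFin U K // dcIdx U V (dcRep U K i * g⁻¹) = j} → Y ⧸ U.subgroupOf Y :=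
    fun i => QuotientGroup.mk ⟨y * (kk i)⁻¹ * y⁻¹, hmemY i⟩
  have hf : Function.Injective f := by
    intro i i' hii'
    have hmem : (⟨y * (kk i)⁻¹ * y⁻¹, hmemY i⟩ : Y)⁻¹ * ⟨y * (kk i')⁻¹ * y⁻¹, hmemY i'⟩ ∈
        U.subgroupOf Y := QuotientGroup.eq.mp hii'
    rw [Subgroup.mem_subgroupOf] at hmem
    change (y * (kk i)⁻¹ * y⁻¹)⁻¹ * (y * (kk i')⁻¹ * y⁻¹) ∈ U at hmem
    -- `x_i x_{i'}⁻¹ ∈ U`, hence the same double coset, hence `i = i'`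
    have hx : dcRep U K i.1 * (dcRep U K i'.1)⁻¹ ∈ U := by
      have e1 : dcRep U K i.1 = uu i * y * kk i * g := by rw [← hdec i]; group
      have e2 : dcRep U K i'.1 = uu i' * y * kk i' * g := by rw [← hdec i']; group
      have e3 : dcRep U K i.1 * (dcRep U K i'.1)⁻¹ =
          uu i * ((y * (kk i)⁻¹ * y⁻¹)⁻¹ * (y * (kk i')⁻¹ * y⁻¹)) * (uu i')⁻¹ := by
        rw [e1, e2]; group
      rw [e3]
      exact U.mul_mem (U.mul_mem (huu i) hmem) (U.inv_mem (huu i'))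
    apply Subtype.ext
    rw [← dcIdx_dcRep U K i.1, ← dcIdx_dcRep U K i'.1, dcIdx_eq_iff]
    refine ⟨(dcRep U K i.1 * (dcRep U K i'.1)⁻¹)⁻¹, U.inv_mem hx, 1, K.one_mem, ?_⟩
    group
  have hcard := Nat.card_le_card_of_injective f hf
  rw [Nat.card_eq_fintype_card, Fintype.card_subtype] at hcard
  exact hcard

end PSCCovering

namespace PSCDatum

open PSCCovering

variable {P : Type u} [Group P] [TopologicalSpace P] [IsTopologicalGroup P] (G : PSCDatum P)
  (U : Subgroup P) [U.FiniteIndex] (hU : IsOpen (U : Set P))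

/-! ### The branch count of a covering vertex -/

omit [IsTopologicalGroup P] in
/-- **`b_w ≤ d_w · b_v`**: the vertex `w` of `G_U` over `v` has at most `d_w · b_v` branches.
[cite: MochizukiCombGC2007, Def 1.1(ii) p.6] -/
theorem branchCount_restrict_le (w : (G.restrictGraph U).V) :
    (G.restrictGraph U).branchCount w ≤ G.localDegree U w * G.graph.branchCount w.1 := by
  classical
  obtain ⟨v, j⟩ := w
  rw [(G.restrictGraph U).branchCount_eq_of_nodeEnds
      (fun d => G.vertexOver U (G.nodeFst d.1) (G.nrep U d * (ConjAct.ofConjAct (G.nodeConjFst d.1))⁻¹))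
      (fun d => G.vertexOver U (G.nodeSnd d.1) (G.nrep U d * (ConjAct.ofConjAct (G.nodeConjSnd d.1))⁻¹))
      (fun d => rfl),
    G.graph.branchCount_eq_of_nodeEnds G.nodeFst G.nodeSnd G.nodeEnds_eq, mul_add,
    Finset.card_filter, Finset.card_filter, Finset.mul_sum, Finset.mul_sum]
  set d := G.localDegree U ⟨v, j⟩ with hd
  -- a fibre count: indices over `c`/`e` whose attached vertex is `(v, j)`
  have key : ∀ (K : Subgroup P) (v' : G.graph.V) (g : P),
      (∑ i : dcFin U K, if G.vertexOver U v' (dcRep U K i * g⁻¹) = ⟨v, j⟩ then 1 else 0) ≤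
        d * (if v' = v then 1 else 0) := by
    intro K v' g
    by_cases hv : v' = v
    · subst hv
      rw [if_pos rfl, mul_one, ← Finset.card_filter]
      have e : (Finset.univ.filter fun i : dcFin U K =>
          G.vertexOver U v' (dcRep U K i * g⁻¹) = ⟨v', j⟩) =
          Finset.univ.filter fun i : dcFin U K => dcIdx U (G.vertGp v') (dcRep U K i * g⁻¹) = j := by
        ext i
        simp [vertexOver]
      rw [e]
      exact card_filter_dcIdx_le U K (G.vertGp v') g j
    · rw [if_neg hv, mul_zero]
      refine le_of_eq (Finset.sum_eq_zero fun i _ => if_neg fun h => hv ?_)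
      exact congrArg Sigma.fst h
  refine add_le_add ?_ ?_
  · -- cusps: sum over `Σ c, dcFin U Π_c`
    refine le_trans (le_of_eq (Fintype.sum_sigma _)) (Finset.sum_le_sum fun c _ => ?_)
    exact key (G.cuspGp c) (G.graph.cuspEnd c) (ConjAct.ofConjAct (G.cuspConj c))
  · -- node-branches: sum over `Σ e, dcFin U Π_e`, two branches each
    refine le_trans (le_of_eq (Fintype.sum_sigma _)) (Finset.sum_le_sum fun e _ => ?_)
    rw [Finset.sum_add_distrib, mul_add]
    exact add_le_add (key (G.nodeGp e) (G.nodeFst e) (ConjAct.ofConjAct (G.nodeConjFst e)))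
      (key (G.nodeGp e) (G.nodeSnd e) (ConjAct.ofConjAct (G.nodeConjSnd e)))

omit [IsTopologicalGroup P] in
/-- The local degree `d_w = [Π_v^y : U ∩ Π_v^y]` is positive (`U` of finite index).
[cite: MochizukiCombGC2007, Def 1.1(ii) p.6] -/
theorem localDegree_pos (w : (G.restrictGraph U).V) : 0 < G.localDegree U w :=
  Nat.pos_of_ne_zero Subgroup.FiniteIndex.index_ne_zero

/-! ### Genera: Riemann–Hurwitz monotonicity and sturdiness -/

/-- **`g_w ≥ g_v` for `g_v ≥ 1`**: by Riemann–Hurwitz, `2 g_w − 2 = d_w (2 g_v − 2) + (d_w b_v − b_w)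
≥ 2 g_v − 2`. [cite: MochizukiCombGC2007, Rmk 1.1.5 p.8] -/
theorem genus_le_restrict_genus (w : (G.restrictGraph U).V) (hg : 1 ≤ G.genus w.1) :
    G.genus w.1 ≤ (G.restrict U hU).genus w := by
  have hb := G.branchCount_restrict_le U w
  have hd := G.localDegree_pos U w
  show G.genus w.1 ≤ hurwitzGenus (G.localDegree U w) (G.genus w.1) (G.graph.branchCount w.1)
    ((G.restrictGraph U).branchCount w)
  unfold hurwitzGenus
  set d := G.localDegree U w
  set gv := G.genus w.1
  set bv := G.graph.branchCount w.1
  set bw := (G.restrictGraph U).branchCount w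
  have hb' : (bw : ℤ) ≤ (d : ℤ) * bv := by exact_mod_cast hb
  have hX : 2 * (gv : ℤ) - 2 ≤ (d : ℤ) * (2 * (gv : ℤ) - 2 + bv) - bw := by
    have hd' : (1 : ℤ) ≤ d := by exact_mod_cast hd
    have hg' : (1 : ℤ) ≤ gv := by exact_mod_cast hg
    nlinarith
  omega

/-- **Coverings of sturdy data are sturdy** ("every irreducible component … of genus `≥ 2`" is
inherited by the components of an admissible covering, by Riemann–Hurwitz).
[cite: MochizukiCombGC2007, Rmk 1.1.5 p.8] -/
theorem IsSturdy.restrict (h : G.IsSturdy) : (G.restrict U hU).IsSturdy := fun w =>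
  (h w.1).trans (G.genus_le_restrict_genus U hU w (le_trans (by norm_num) (h w.1)))

/-! ### Cusps: a covering is noncuspidal iff the base is -/

omit [IsTopologicalGroup P] in
/-- `r(G_U) = 0 ↔ r(G) = 0`: every cusp has at least one cusp above it.
[cite: MochizukiCombGC2007, Def 1.1(ii) p.6] -/
theorem cuspCount_eq_zero_iff : G.cuspCount U = 0 ↔ G.graph.r = 0 := by
  haveI : ∀ c, Finite (DoubleCoset.Quotient (U : Set P) (G.cuspGp c : Set P)) :=
    fun c => finite_doubleCosetQuotient U _
  rw [cuspCount, Finset.sum_eq_zero_iff, PSCSemiGraph.r, Fintype.card_eq_zero_iff]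
  constructor
  · intro h
    exact ⟨fun c => (Nat.card_pos (α := DoubleCoset.Quotient (U : Set P) (G.cuspGp c : Set P))).ne'
      (h c (Finset.mem_univ c))⟩
  · intro h c _
    exact (h.false c).elim

/-- `G_U` is noncuspidal iff `G` is. [cite: MochizukiCombGC2007, Def 1.1(i)-(ii) p.6] -/
theorem isNoncuspidal_restrict_iff :
    (G.restrict U hU).graph.IsNoncuspidal ↔ G.graph.IsNoncuspidal := by
  rw [PSCSemiGraph.IsNoncuspidal, PSCSemiGraph.IsNoncuspidal, restrict_graph]
  show Fintype.card (Σ c : G.graph.C, dcFin U (G.cuspGp c)) = 0 ↔ _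
  rw [Fintype.card_sigma]
  have : (∑ c : G.graph.C, Fintype.card (dcFin U (G.cuspGp c))) = G.cuspCount U := by
    simp [cuspCount]
  rw [this, cuspCount_eq_zero_iff]

end PSCDatum

end Literature.AnabelianGeometry.SemiGraphs
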